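import Summits.ABC.StewartYu.PadicG3ParVJ
import Summits.ABC.StewartYu.RecordByNameV
import HarnessLib

/-!
# The `p`-adic Gen-3 parameter record v2 (corrected family `…V`) — part VK: the main-term headline block `g²·LgV ≤ 2^{27}·C_bⁿ·Ω·p`

Support file (plain theorems; no named facts). Continues `PadicG3ParVJ`. First half of the m = 0 HEADLINE
(`8·2ⁿ·Zp + CondFloorV n ≤ U(Λ)`, plan g9 2026-08-27T04:41:32Z; spec HOME/p1/HEADLINE-V-spec.md §1): under the
m = 0 context (`m = 0`, `θ₀ = ½`, `n ≥ 2`, `A j ≥ 1`, `Amax ≤ 2ⁿΩ`, `N_q = K`) the excess gain disappears from the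
multiplicity scale: **`g²·LgV ≤ 2^{27}·C_bⁿ·Ω·p`**. Ingredients: `g²LgV ≤ 264 C_bⁿΩK + gⁿ·RLgV` (VH),
`gⁿ ≤ q := exp(log p/4)` with `q⁴ = p` (VI), `RLgV ≤ 2^{n+25} + 2Amax + 4ŜG + 11` and `ŜG ≤ n + 26 + (log N_q + log g)/log 2 ≤ 3·log p` (VI, VJ),
`log p ≤ 4q`, `K ≤ p`.

## References
* [Yu2013] K. Yu, Acta Math. 211 (2013) — Theorem 1 (shape of the main term).
-/

noncomputable section

open Finset Real

namespace Summit.ABC.StewartYu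

namespace PadicG3Par

variable {n : ℕ} (P : PadicG3Par n)

/-- at `m = 0`: `K ≤ p` (real; `K = K₀ ≤ p`). [folklore] -/
theorem K_le_p (hm : P.m = 0) : (P.K : ℝ) ≤ P.p := by
  have h : P.K ≤ P.p := by unfold K; rw [hm]; simpa using P.hK₀p
  exact_mod_cast h

/-- `2 ≤ C_b` (indeed `C_b = 32e`). [folklore] -/
theorem two_le_Cb : (2 : ℝ) ≤ Cb := by
  unfold Cb cM
  have := Real.add_one_le_exp (1 : ℝ)
  push_cast; nlinarith

/-- `log p ≤ 4·exp(log p/4)`. [folklore] -/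
theorem log_p_le_four_exp : Real.log P.p ≤ 4 * Real.exp (Real.log P.p / 4) := by
  have := Real.add_one_le_exp (Real.log P.p / 4); linarith

/-- at `m = 0`, `θ₀ = ½`, `N_q = K`: **`ŜG ≤ 3·log p`**. [folklore] -/
theorem SdG_le_log (hm : P.m = 0) (hθ : P.θ₀ = 1 / 2) (hNq : P.Nq = P.K) : (P.SdG : ℝ) ≤ 3 * Real.log P.p := by
  have h1 := P.SdG_le_real
  have hl := P.sixteen_mul_le_log_p hm hθ
  have hn1 : (1 : ℝ) ≤ n := by exact_mod_cast P.hn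
  have hl2 : (69 / 100 : ℝ) < Real.log 2 := by have := Real.log_two_gt_d9; linarith
  have hl2' : Real.log 2 < 1 := by have := Real.log_two_lt_d9; linarith
  have hg1 := P.one_le_g
  have hgl := P.g_le_log_div hm
  -- `log N_q = log K ≤ log p`, `log g ≤ g − 1 ≤ log p/48`
  have hNq0 : (0 : ℝ) < P.Nq := by exact_mod_cast P.hNq
  have hlogNq : Real.log P.Nq ≤ Real.log P.p := by
    have hK := P.K_le_p hm
    have : (P.Nq : ℝ) ≤ P.p := by rw [hNq]; exact hK
    exact Real.log_le_log hNq0 this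
  have hlogNq0 : 0 ≤ Real.log (P.Nq : ℝ) := Real.log_nonneg (by exact_mod_cast P.hNq)
  have hlogg : Real.log P.g ≤ Real.log P.p / 8 := by
    have h2 := Real.log_le_sub_one_of_pos (lt_of_lt_of_le one_pos hg1)
    have h3 : P.g * (4 * ((n : ℝ) + 1)) ≤ Real.log P.p := (le_div_iff₀ (by positivity)).mp hgl
    have h4 : P.g * 8 ≤ P.g * (4 * ((n : ℝ) + 1)) := by nlinarith
    linarith
  have hlogg0 : 0 ≤ Real.log P.g := Real.log_nonneg hg1
  -- divide by `log 2 > 0.69`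
  have hsum : (Real.log P.Nq + Real.log P.g) / Real.log 2 ≤ 2 * Real.log P.p := by
    rw [div_le_iff₀ (by linarith)]
    have hl0 : 0 ≤ Real.log (P.p : ℝ) := P.log_p_pos.le
    nlinarith
  have hn26 : (n : ℝ) + 26 ≤ Real.log P.p := by linarith
  linarith

/-- at `m = 0`, …: **`RLgV ≤ 2^{n+25} + 2·Amax + 13·log p`**. [folklore] -/
theorem RLgV_le_log (hm : P.m = 0) (hθ : P.θ₀ = 1 / 2) (hNq : P.Nq = P.K) :
    P.RLgV ≤ 2 ^ (n + 25) + 2 * P.Amax + 13 * Real.log P.p := by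
  have h1 := P.RLgV_le
  have h2 := P.SdG_le_log hm hθ hNq
  have hl := P.sixteen_mul_le_log_p hm hθ
  have hn1 : (1 : ℝ) ≤ n := by exact_mod_cast P.hn
  have hl32 : (32 : ℝ) ≤ Real.log P.p := by linarith
  linarith

/-- **THE MAIN-TERM BLOCK: `g²·LgV ≤ 2^{27}·C_bⁿ·Ω·p`** (m = 0, `θ₀ = ½`, `n ≥ 2`, `A j ≥ 1`, `Amax ≤ 2ⁿΩ`, `N_q = K`).
[cite: Yu2013, Theorem 1 (shape)] -/
theorem g_sq_LgV_le_main (hm : P.m = 0) (hθ : P.θ₀ = 1 / 2) (hn2 : 2 ≤ n) (hA1 : ∀ j, 1 ≤ P.A j)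
    (hAmaxΩ : P.Amax ≤ 2 ^ n * P.Ω) (hNq : P.Nq = P.K) :
    P.g ^ 2 * P.LgV ≤ 2 ^ 27 * Cb ^ n * P.Ω * P.p := by
  have hθ' : 1 / 2 ≤ P.θ₀ := by rw [hθ]
  have hNqK : P.Nq ≤ 2 ^ n * P.K := by
    rw [hNq]; exact Nat.le_mul_of_pos_left _ (by positivity)
  have h1 := P.g_sq_mul_LgV_le hn2 hθ' hNqK
  obtain ⟨q, hqdef⟩ : ∃ q : ℝ, q = Real.exp (Real.log P.p / 4) := ⟨_, rfl⟩
  have hq : P.g ^ n ≤ q := by rw [hqdef]; exact P.g_pow_le_exp hm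
  have hq4 : q ^ 4 = P.p := by rw [hqdef]; exact P.exp_log_div_four_pow
  have hlq : Real.log P.p ≤ 4 * q := by rw [hqdef]; exact P.log_p_le_four_exp
  have hq1 : 1 ≤ q := by rw [hqdef]; exact Real.one_le_exp (by have := P.log_p_pos; positivity)
  have hR := P.RLgV_le_log hm hθ hNq
  have hR0 := P.RLgV_nonneg
  have hΩ := P.one_le_Ω hA1
  have hK := P.K_le_p hm
  have hp : (2 : ℝ) ≤ P.p := P.two_le_p
  have hp0 : (0 : ℝ) ≤ P.p := by linarith
  have hq0 : (0 : ℝ) ≤ q := by linarith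
  have hCbn : (2 : ℝ) ^ n ≤ Cb ^ n := pow_le_pow_left₀ (by norm_num) two_le_Cb n
  have hCbn1 : (1 : ℝ) ≤ Cb ^ n := le_trans (one_le_pow₀ (by norm_num : (1:ℝ) ≤ 2)) hCbn
  -- `q ≤ p`, `q² ≤ p`
  have hqp : q ≤ P.p := by rw [← hq4]; exact le_self_pow₀ hq1 (by norm_num)
  have hq2 : q ^ 2 ≤ P.p := by rw [← hq4]; exact pow_le_pow_right₀ hq1 (by norm_num)
  -- `gⁿ · RLgV ≤ q · (2^{n+25} + 2 Amax + 13 log p) ≤ p 2^{n+25} + 2^{n+1} Ω p + 52 p`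
  have hA0 : 0 ≤ P.Amax := le_trans (P.A_pos ⟨0, by omega⟩).le (P.hAmax _)
  have hstep : P.g ^ n * P.RLgV ≤ q * (2 ^ (n + 25) + 2 * P.Amax + 13 * Real.log P.p) :=
    mul_le_mul hq hR hR0 hq0
  have hterm1 : q * 2 ^ (n + 25) ≤ P.p * 2 ^ (n + 25) := mul_le_mul_of_nonneg_right hqp (by positivity)
  have hterm2 : q * (2 * P.Amax) ≤ 2 ^ (n + 1) * P.Ω * P.p := by
    have := mul_le_mul hqp hAmaxΩ hA0 hp0
    have e : (2 : ℝ) ^ (n + 1) * P.Ω * P.p = 2 * (P.p * (2 ^ n * P.Ω)) := by rw [pow_succ]; ring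
    rw [e]; linarith
  have hterm3 : q * (13 * Real.log P.p) ≤ 52 * P.p := by
    have h13 : q * (13 * Real.log P.p) ≤ q * (13 * (4 * q)) := mul_le_mul_of_nonneg_left (by linarith) hq0
    have e : q * (13 * (4 * q)) = 52 * q ^ 2 := by ring
    linarith
  have e1 : q * (2 ^ (n + 25) + 2 * P.Amax + 13 * Real.log P.p) =
      q * 2 ^ (n + 25) + q * (2 * P.Amax) + q * (13 * Real.log P.p) := by ring
  have hgR : P.g ^ n * P.RLgV ≤ P.p * 2 ^ (n + 25) + 2 ^ (n + 1) * P.Ω * P.p + 52 * P.p := by linarith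
  -- the Siegel part
  have hS : 264 * Cb ^ n * P.Ω * P.K ≤ 264 * Cb ^ n * P.Ω * P.p := by
    have h0 : 0 ≤ 264 * Cb ^ n * P.Ω := by have := Cb_pos; positivity
    exact mul_le_mul_of_nonneg_left hK h0
  -- absorb `Ω ≥ 1`
  have hΩp : 0 ≤ P.Ω * P.p := by positivity
  have hA : P.p * 2 ^ (n + 25) ≤ 2 ^ (n + 25) * P.Ω * P.p := by
    have h0 : (0 : ℝ) ≤ P.p * 2 ^ (n + 25) := by positivity
    have := mul_le_mul_of_nonneg_right hΩ h0
    have e : (2 : ℝ) ^ (n + 25) * P.Ω * P.p = P.Ω * (P.p * 2 ^ (n + 25)) := by ring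
    linarith
  have hB : 52 * P.p ≤ 52 * P.Ω * P.p := by
    have h0 : (0 : ℝ) ≤ 52 * P.p := by positivity
    have := mul_le_mul_of_nonneg_right hΩ h0
    have e : (52 : ℝ) * P.Ω * P.p = P.Ω * (52 * P.p) := by ring
    linarith
  have hsum : P.g ^ 2 * P.LgV ≤ (264 * Cb ^ n + 2 ^ (n + 25) + 2 ^ (n + 1) + 52) * (P.Ω * P.p) := by
    have e : (264 * Cb ^ n + 2 ^ (n + 25) + 2 ^ (n + 1) + 52) * (P.Ω * P.p) =
        264 * Cb ^ n * P.Ω * P.p + 2 ^ (n + 25) * P.Ω * P.p + 2 ^ (n + 1) * P.Ω * P.p + 52 * P.Ω * P.p := by ring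
    have h2 : (2 : ℝ) ^ (n + 1) * P.Ω * P.p ≤ 2 ^ (n + 1) * P.Ω * P.p := le_rfl
    linarith
  have hcoef : 264 * Cb ^ n + 2 ^ (n + 25) + 2 ^ (n + 1) + 52 ≤ 2 ^ 27 * Cb ^ n := by
    have e1 : (2 : ℝ) ^ (n + 25) = 2 ^ 25 * 2 ^ n := by rw [pow_add]; ring
    have e2 : (2 : ℝ) ^ (n + 1) = 2 * 2 ^ n := by rw [pow_succ]; ring
    rw [e1, e2]
    norm_num
    linarith
  calc P.g ^ 2 * P.LgV ≤ (264 * Cb ^ n + 2 ^ (n + 25) + 2 ^ (n + 1) + 52) * (P.Ω * P.p) := hsum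
    _ ≤ 2 ^ 27 * Cb ^ n * (P.Ω * P.p) := mul_le_mul_of_nonneg_right hcoef hΩp
    _ = 2 ^ 27 * Cb ^ n * P.Ω * P.p := by ring

end PadicG3Par

end Summit.ABC.StewartYu
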